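import Summits.QuantumFields.YangMills.Theorems.WeakCouplingRatesBoxCutoff
import Summits.QuantumFields.YangMills.Theorems.WeakCouplingRatesCurvatureKernel

/-!
# Crux `ColdBoxTwoPointFloorW` (stmt-QuantumFields-19608), stub S4 `stub_boxKernelVsLattice`: the free comb-gauge box
# Maxwell kernel versus the `ℤ⁴` curvature kernel at depth `T = ⌈β^A⌉ ≪ H = ⌈β^θ⌉`

Route `WeakCouplingRates` (rev 2), line `birth`, registered skeleton v5 (sha16 `541595052a14e13c`), fleet seat `ym-wcr-19608-p2`.
This file proves the registered stub BY NAME AND SIGNATURE: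

`stub_boxKernelVsLattice : ∀ A θ : ℝ, 0 < A → A < θ → ∃ c₁ : ℝ, 0 < c₁ ∧ ∃ β₀ : ℝ, ∀ β : ℝ, β₀ ≤ β →
  c₁ * |curvaturePlaquetteCorr 4 ⌈β^A⌉| ≤ |boxMaxwellPlaqCov ⌈β^θ⌉ ⌈β^A⌉|` — with `c₁ = ½`, for ALL `0 < A < θ` (no window).

## The argument (all inputs are tree theorems)

1. `boxMaxwellPlaqCov H T = λ_{p_c}·Q⁻¹λ_{p_c+Te₀}` (`boxMaxwellPlaqCov_eq_dotProduct`) is the kernel `boxProjKernel` of the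
   orthogonal projection of `ℝ^{plaquettes of the box}` onto the curls of comb-gauge edge functions
   (`Theorems/WeakCouplingRatesBoxProjection.lean`).
2. On `ℤ⁴` the point mass at a plaquette splits as `δ_q = d₁(div₂ g_q) + div₃(d₂ g_q)`, `g_q = ½G(·−x_q)⊗ω` (lattice Hodge
   identity `LatticeChain.div₃_d₂_add_d₁_div₂` + `latticeLaplacianZd_half_latticeGreen`); the curl part is a box curl (comb gauge,
   `AxialGauge.gaugeFix` in `Multiplicative ℝ`) and — `curvatureTwoPoint_eq_curl_greenTensor`, `…CurvatureKernel.lean` — its value at `p` is the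
   `ℤ⁴` curvature kernel `curvatureTwoPoint p q`; the divergence of the co-potential cut off inside the box is orthogonal to all
   curls (`LatticeChain.pair₂_div₃`, `LatticeForm.d₂_d₁`).  Hence `Π_H(p,q) = C(p,q) + ⟨Z_p, V_q⟩ + ⟨KV_p, KV_q⟩`
   (`Theorems/WeakCouplingRatesBoxHodge.lean`).
3. Lawler's bounds `|∇G| = O(r⁻³)`, `|∇∇G| = O(r⁻⁴)` (tree `latticeGreen_gradient_bound`, `latticeGreen_second_diff_bound`) and a
   ramp cut-off of slope `2/H` give `|Π_H(T) − C(T)| ≤ K_E/H⁴` for `T ≤ H/8`, `H ≥ 32`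
   (`Theorems/WeakCouplingRatesBoxDecay.lean`, `…BoxCutoff.lean`).
4. `C(T) = −[Δ₁G + Δ₂G](−Te₀)/2 = T⁻⁴/π² + O(T⁻⁵)` (`…CurvatureKernel.lean`: `curvaturePlaquetteCorr_eq_second_diff`,
   `exists_curvaturePlaquetteCorr_asymp`, from Lawler (1.37), tree `latticeGreen_second_diff_continuum`).
5. With `H/T ≥ β^{θ−A}/2 → ∞` the error is `≤ C(T)/2` eventually, so `Π_H(T) ≥ C(T)/2 > 0` (`half_abs_curvaturePlaquetteCorr_le` and
   the exponent bookkeeping in `stub_boxKernelVsLattice`).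

No sorry, standard axioms, no new definition, no named-fact hypothesis.  NOT a claim about the mass gap: a statement about two
Gaussian (free-field) kernels.
-/

set_option autoImplicit false

noncomputable section

open Finset Real
open Literature.Probability.LatticeModels
open Literature.MathematicalPhysics.QuantumLattice
open Literature.MathematicalPhysics.QuantumFieldTheory
open Literature.MathematicalPhysics.QuantumFieldTheory.LatticeMaxwell
open Literature.MathematicalPhysics.QuantumFieldTheory.AxialGauge
open Literature.MathematicalPhysics.QuantumFieldTheory.LatticeChain
open Literature.MathematicalPhysics.QuantumFieldTheory.LatticeForm (e d₁ d₂)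

namespace Summit.QuantumFields.YangMills.Theorems.WeakCouplingRates

/-! ## The two central plaquettes and the deterministic inequality -/

/-- The central `(1,2)`-plaquette `p_c` and its translate `p_c + Te₀` (`T ≤ H`, `H ≥ 1`) are plaquettes of the box
`{0,…,2H}⁴`. -/
theorem plaq12At_centre_mem {H T : ℕ} (hH : 1 ≤ H) (hT : T ≤ H) :
    plaq12At (boxCentre H) ∈ plaquettesIn (halfOpenBox 4 (2 * H + 1)) ∧
      plaq12At (boxCentre H + Pi.single 0 (T : ℤ)) ∈ plaquettesIn (halfOpenBox 4 (2 * H + 1)) := by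
  have hmem : ∀ v : Site 4, (∀ m, 0 ≤ v m ∧ v m ≤ (H : ℤ)) → boxCentre H + v ∈ halfOpenBox 4 (2 * H + 1) := by
    intro v hv
    rw [mem_halfOpenBox]
    intro m
    have := hv m
    simp only [Pi.add_apply, boxCentre]
    push_cast
    constructor <;> omega
  have hH' : (1 : ℤ) ≤ H := by exact_mod_cast hH
  have hT' : (T : ℤ) ≤ H := by exact_mod_cast hT
  have b1 : ∀ (i : Fin 4) (m : Fin 4), 0 ≤ (Pi.single i (1 : ℤ) : Site 4) m ∧ (Pi.single i (1 : ℤ) : Site 4) m ≤ H := by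
    intro i m; simp only [Pi.single_apply]; split_ifs <;> omega
  have b2 : ∀ (i j : Fin 4), i ≠ j → ∀ m : Fin 4, 0 ≤ (Pi.single i (1 : ℤ) + Pi.single j 1 : Site 4) m ∧
      (Pi.single i (1 : ℤ) + Pi.single j 1 : Site 4) m ≤ H := by
    intro i j hij m
    simp only [Pi.add_apply, Pi.single_apply]
    by_cases h1 : m = i
    · subst h1; simp [hij, hH]
    · by_cases h2 : m = j
      · subst h2; simp [h1, hH]
      · simp [h1, h2]
  have bT : ∀ m : Fin 4, 0 ≤ (Pi.single 0 (T : ℤ) : Site 4) m ∧ (Pi.single 0 (T : ℤ) : Site 4) m ≤ H := by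
    intro m; simp only [Pi.single_apply]; split_ifs <;> omega
  have bT1 : ∀ (i : Fin 4), i ≠ 0 → ∀ m : Fin 4, 0 ≤ (Pi.single 0 (T : ℤ) + Pi.single i 1 : Site 4) m ∧
      (Pi.single 0 (T : ℤ) + Pi.single i 1 : Site 4) m ≤ H := by
    intro i hi m
    simp only [Pi.add_apply, Pi.single_apply]
    by_cases h1 : m = 0
    · subst h1; simp [hi.symm]; omega
    · by_cases h2 : m = i
      · subst h2; simp [h1, hH]
      · simp [h1, h2]
  have bT2 : ∀ m : Fin 4, 0 ≤ (Pi.single 0 (T : ℤ) + Pi.single 1 1 + Pi.single 2 1 : Site 4) m ∧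
      (Pi.single 0 (T : ℤ) + Pi.single 1 1 + Pi.single 2 1 : Site 4) m ≤ H := by
    intro m
    simp only [Pi.add_apply, Pi.single_apply]
    by_cases h1 : m = 0
    · subst h1; simp; omega
    · by_cases h2 : m = 1
      · subst h2; simp [hH]
      · by_cases h3 : m = 2
        · subst h3; simp [hH]
        · simp [h1, h2, h3]
  have hlt : (1 : Fin 4) < 2 := by decide
  have hc : boxCentre H ∈ halfOpenBox 4 (2 * H + 1) := by simpa using hmem 0 (fun m => by simp)
  refine ⟨Plaq.mem_plaquettesIn.2 ⟨hc, hlt, hmem _ (b1 1), hmem _ (b1 2), ?_⟩,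
    Plaq.mem_plaquettesIn.2 ⟨hmem _ bT, hlt, ?_, ?_, ?_⟩⟩
  · simp only [plaq12At, add_assoc]; exact hmem _ (b2 1 2 (by decide))
  · simp only [plaq12At, add_assoc]; exact hmem _ (bT1 1 (by decide))
  · simp only [plaq12At, add_assoc]; exact hmem _ (bT1 2 (by decide))
  · simp only [plaq12At, add_assoc]
    have : (Pi.single 0 (T : ℤ) + (Pi.single 1 1 + Pi.single 2 1) : Site 4) =
        Pi.single 0 (T : ℤ) + Pi.single 1 1 + Pi.single 2 1 := by abel
    rw [this]; exact hmem _ bT2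

/-- **The deterministic inequality**: with the error constant `K_E` of `exists_boxProjKernel_sub_curl_bound` and the
asymptotic constant `K_C` of `exists_curvaturePlaquetteCorr_asymp`, if `H ≥ 32`, `1 ≤ T ≤ H/8`,
`K_E/H⁴ ≤ (1/(4π²))/T⁴` and `K_C/T⁵ ≤ (1/(2π²))/T⁴`, then `½|C(T)| ≤ |boxMaxwellPlaqCov H T|`. -/
theorem half_abs_curvaturePlaquetteCorr_le {K_E K_C : ℝ}
    (hE : ∀ (H : ℕ), (32 : ℝ) ≤ H → ∀ (p q : Plaq 4), p ∈ plaquettesIn (halfOpenBox 4 (2 * H + 1)) →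
      q ∈ plaquettesIn (halfOpenBox 4 (2 * H + 1)) → ‖p.1 - boxCentre H‖ ≤ (H : ℝ) / 8 → ‖q.1 - boxCentre H‖ ≤ (H : ℝ) / 8 →
      |boxProjKernel H p q - d₁ (div₂ (greenTensor q)) p.1 p.2.1 p.2.2| ≤ K_E / (H : ℝ) ^ 4)
    (hC : ∀ T : ℕ, 1 ≤ T → |@Literature.MathematicalPhysics.QuantumFieldTheory.curvaturePlaquetteCorr 4 (by norm_num) (T : ℤ) -
        1 / π ^ 2 / (T : ℝ) ^ 4| ≤ K_C / (T : ℝ) ^ 5)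
    {H T : ℕ} (hH : (32 : ℝ) ≤ H) (hT1 : 1 ≤ T) (hTH : (T : ℝ) ≤ (H : ℝ) / 8)
    (hEH : K_E / (H : ℝ) ^ 4 ≤ 1 / (4 * π ^ 2) / (T : ℝ) ^ 4) (hCT : K_C / (T : ℝ) ^ 5 ≤ 1 / (2 * π ^ 2) / (T : ℝ) ^ 4) :
    1 / 2 * |@Literature.MathematicalPhysics.QuantumFieldTheory.curvaturePlaquetteCorr 4 (by norm_num) (T : ℤ)| ≤
      |boxMaxwellPlaqCov H T| := by
  have hH1 : 1 ≤ H := by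
    have : (1 : ℝ) ≤ H := by linarith
    exact_mod_cast this
  have hTH' : T ≤ H := by
    have : (T : ℝ) ≤ H := by linarith [show (0 : ℝ) ≤ H by positivity]
    exact_mod_cast this
  obtain ⟨hp, hq⟩ := plaq12At_centre_mem hH1 hTH'
  -- the box kernel at the central pair
  have hker : boxMaxwellPlaqCov H T = boxProjKernel H (plaq12At (boxCentre H)) (plaq12At (boxCentre H + Pi.single 0 (T : ℤ))) := by
    rw [boxMaxwellPlaqCov_eq_dotProduct]; rfl
  have hpc : ‖(plaq12At (boxCentre H)).1 - boxCentre H‖ ≤ (H : ℝ) / 8 := by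
    simp only [plaq12At, sub_self, norm_zero]; positivity
  have hqc : ‖(plaq12At (boxCentre H + Pi.single 0 (T : ℤ))).1 - boxCentre H‖ ≤ (H : ℝ) / 8 := by
    simp only [plaq12At, add_sub_cancel_left, Pi.norm_single, Int.norm_natCast]
    exact hTH
  have herr := hE H hH _ _ hp hq hpc hqc
  rw [← hker] at herr
  have hcentre : d₁ (div₂ (greenTensor (plaq12At (boxCentre H + Pi.single 0 (T : ℤ))))) (plaq12At (boxCentre H)).1
      (plaq12At (boxCentre H)).2.1 (plaq12At (boxCentre H)).2.2 =
      @Literature.MathematicalPhysics.QuantumFieldTheory.curvaturePlaquetteCorr 4 (by norm_num) (T : ℤ) :=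
    curl_greenTensor_centre H T
  rw [hcentre] at herr
  have hasy := hC T hT1
  set C := @Literature.MathematicalPhysics.QuantumFieldTheory.curvaturePlaquetteCorr 4 (by norm_num) (T : ℤ) with hCdef
  have hT0 : (0 : ℝ) < T := by exact_mod_cast hT1
  have hu : 0 < 1 / π ^ 2 / (T : ℝ) ^ 4 := by positivity
  have e1 : 1 / (2 * π ^ 2) / (T : ℝ) ^ 4 = (1 / π ^ 2 / (T : ℝ) ^ 4) / 2 := by field_simp
  have e2 : 1 / (4 * π ^ 2) / (T : ℝ) ^ 4 = (1 / π ^ 2 / (T : ℝ) ^ 4) / 4 := by field_simp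
  rw [e1] at hCT
  rw [e2] at hEH
  rw [abs_le] at hasy herr
  have hCpos : 0 ≤ C := by linarith [hasy.1]
  have hB : C / 2 ≤ boxMaxwellPlaqCov H T := by linarith [herr.1, hasy.1]
  rw [abs_of_nonneg hCpos, abs_of_nonneg (by linarith)]
  linarith

/-! ## The stub: exponent bookkeeping `T = ⌈β^A⌉`, `H = ⌈β^θ⌉` -/

/-- Root bookkeeping: if `0 ≤ x`, `0 < s` and `x^{1/s} ≤ β` then `x ≤ β^s`. -/
theorem le_rpow_of_root_le {x s β : ℝ} (hx : 0 ≤ x) (hs : 0 < s) (hβ : x ^ (1 / s) ≤ β) : x ≤ β ^ s := by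
  have h0 : 0 ≤ x ^ (1 / s) := Real.rpow_nonneg hx _
  have := Real.rpow_le_rpow h0 hβ hs.le
  rwa [one_div, Real.rpow_inv_rpow hx hs.ne'] at this

/-- **Stub S4 of crux `ColdBoxTwoPointFloorW` (line `birth`, skeleton v5): the free comb-gauge box Maxwell kernel dominates
the `ℤ⁴` kernel at depth `T = ⌈β^A⌉ ≪ H = ⌈β^θ⌉`.**  For all exponents `0 < A < θ` there are `c₁ > 0` (here `½`) and `β₀`
with `c₁ |C(⌈β^A⌉)| ≤ |boxMaxwellPlaqCov ⌈β^θ⌉ ⌈β^A⌉|` for `β ≥ β₀`.  Proof: the box kernel is the orthogonal projection of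
`ℝ^{plaquettes}` onto box curls (`Theorems/WeakCouplingRatesBoxProjection.lean`); the lattice Hodge split of the point mass,
the comb gauge and a ramp cut-off of the co-potential give `|Π_H(T) − C(T)| ≤ K/H⁴`
(`…BoxHodge`, `…BoxDecay`, `…BoxCutoff`, Lawler (1.36)/(1.37) from the tree); and `C(T) = T⁻⁴/π² + O(T⁻⁵)`
(`exists_curvaturePlaquetteCorr_asymp`).  No exponent window is needed: only `H/T = β^{θ−A} → ∞` is used. -/
theorem stub_boxKernelVsLattice : ∀ A θ : ℝ, 0 < A → A < θ → ∃ c₁ : ℝ, 0 < c₁ ∧ ∃ β₀ : ℝ, ∀ β : ℝ, β₀ ≤ β → c₁ * |@Literature.MathematicalPhysics.QuantumFieldTheory.curvaturePlaquetteCorr 4 (by norm_num) (⌈β ^ A⌉₊ : ℤ)| ≤ |boxMaxwellPlaqCov ⌈β ^ θ⌉₊ ⌈β ^ A⌉₊| := by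
  intro A θ hA hAθ
  obtain ⟨K_E, hKE0, hE⟩ := exists_boxProjKernel_sub_curl_bound
  obtain ⟨K_C, hKC0, hC⟩ := exists_curvaturePlaquetteCorr_asymp
  have hθ : 0 < θ := hA.trans hAθ
  have hθA : 0 < θ - A := by linarith
  -- the thresholds
  set M : ℝ := 1 + 4 * π ^ 2 * K_E with hM
  have hM0 : 0 ≤ 4 * π ^ 2 * K_E := by positivity
  have hM1 : 1 ≤ M := by linarith
  set L : ℝ := 2 * π ^ 2 * K_C + 1 with hL
  have hL0 : 0 ≤ 2 * π ^ 2 * K_C := by positivity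
  have hL1 : 1 ≤ L := by linarith
  set β₀ : ℝ := max (max 1 ((32 : ℝ) ^ (1 / θ))) (max ((16 * M) ^ (1 / (θ - A))) (L ^ (1 / A))) with hβ₀
  refine ⟨1 / 2, by norm_num, β₀, fun β hβ => ?_⟩
  have hβ1 : 1 ≤ β := le_trans (le_trans (le_max_left _ _) (le_max_left _ _)) hβ
  have hβ0 : 0 ≤ β := by linarith
  -- the powers of `β`
  have hθpow : (32 : ℝ) ≤ β ^ θ :=
    le_rpow_of_root_le (by norm_num) hθ (le_trans (le_trans (le_max_right _ _) (le_max_left _ _)) hβ)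
  have hdiff : 16 * M ≤ β ^ (θ - A) :=
    le_rpow_of_root_le (by positivity) hθA (le_trans (le_trans (le_max_left _ _) (le_max_right _ _)) hβ)
  have hApow : L ≤ β ^ A :=
    le_rpow_of_root_le (by positivity) hA (le_trans (le_trans (le_max_right _ _) (le_max_right _ _)) hβ)
  have hA1 : 1 ≤ β ^ A := hL1.trans hApow
  have hsplit : β ^ θ = β ^ (θ - A) * β ^ A := by
    rw [← Real.rpow_add (by linarith)]; ring_nf
  -- `T` and `H`
  set T : ℕ := ⌈β ^ A⌉₊ with hT
  set H : ℕ := ⌈β ^ θ⌉₊ with hH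
  have hT_ge : β ^ A ≤ (T : ℝ) := Nat.le_ceil _
  have hT_lt : (T : ℝ) < β ^ A + 1 := Nat.ceil_lt_add_one (by positivity)
  have hT_le : (T : ℝ) ≤ 2 * β ^ A := by linarith
  have hH_ge : β ^ θ ≤ (H : ℝ) := Nat.le_ceil _
  have hT1 : 1 ≤ T := by
    have : (1 : ℝ) ≤ T := hA1.trans hT_ge
    exact_mod_cast this
  have hT0 : (0 : ℝ) < T := by exact_mod_cast hT1
  have hH32 : (32 : ℝ) ≤ H := hθpow.trans hH_ge
  have hH0 : (0 : ℝ) < H := by linarith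
  -- `H ≥ M · T` and `T ≤ H/8`
  have hHT : M * (T : ℝ) ≤ (H : ℝ) / 8 := by
    have h1 : M * (T : ℝ) ≤ M * (2 * β ^ A) := mul_le_mul_of_nonneg_left hT_le (by linarith)
    have h2 : 16 * M * β ^ A ≤ β ^ (θ - A) * β ^ A := mul_le_mul_of_nonneg_right hdiff (by linarith)
    rw [← hsplit] at h2
    linarith
  have hTH : (T : ℝ) ≤ (H : ℝ) / 8 := by
    have : (T : ℝ) ≤ M * T := le_mul_of_one_le_left hT0.le hM1
    linarith
  -- `K_E / H⁴ ≤ (1/(4π²))/T⁴`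
  have hEH : K_E / (H : ℝ) ^ 4 ≤ 1 / (4 * π ^ 2) / (T : ℝ) ^ 4 := by
    have hMT : M * (T : ℝ) ≤ H := by linarith
    have hMT4 : (M * (T : ℝ)) ^ 4 ≤ (H : ℝ) ^ 4 := pow_le_pow_left₀ (by positivity) hMT 4
    have hM4 : 4 * π ^ 2 * K_E ≤ M ^ 4 := by
      have : M ≤ M ^ 4 := by
        calc M = M ^ 1 := (pow_one M).symm
          _ ≤ M ^ 4 := pow_le_pow_right₀ hM1 (by norm_num)
      linarith
    rw [div_le_div_iff₀ (by positivity) (by positivity)]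
    calc K_E * (T : ℝ) ^ 4 = (4 * π ^ 2 * K_E) * (T : ℝ) ^ 4 * (1 / (4 * π ^ 2)) := by field_simp
      _ ≤ M ^ 4 * (T : ℝ) ^ 4 * (1 / (4 * π ^ 2)) := by gcongr
      _ = 1 / (4 * π ^ 2) * (M * (T : ℝ)) ^ 4 := by ring
      _ ≤ 1 / (4 * π ^ 2) * (H : ℝ) ^ 4 := mul_le_mul_of_nonneg_left hMT4 (by positivity)
  -- `K_C / T⁵ ≤ (1/(2π²))/T⁴`
  have hCT : K_C / (T : ℝ) ^ 5 ≤ 1 / (2 * π ^ 2) / (T : ℝ) ^ 4 := by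
    have hLT : L ≤ (T : ℝ) := hApow.trans hT_ge
    have hKT : 2 * π ^ 2 * K_C ≤ (T : ℝ) := by linarith
    rw [div_le_div_iff₀ (by positivity) (by positivity)]
    calc K_C * (T : ℝ) ^ 4 = (2 * π ^ 2 * K_C) * (T : ℝ) ^ 4 * (1 / (2 * π ^ 2)) := by field_simp
      _ ≤ (T : ℝ) * (T : ℝ) ^ 4 * (1 / (2 * π ^ 2)) := by gcongr
      _ = 1 / (2 * π ^ 2) * (T : ℝ) ^ 5 := by ring
  exact half_abs_curvaturePlaquetteCorr_le hE hC hH32 hT1 hTH hEH hCT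

end Summit.QuantumFields.YangMills.Theorems.WeakCouplingRates

end
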